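import Literature.IUT.HodgeArakelov.ThetaSettingHextGeometricCoreAtModelTate
import HarnessLib

/-!
# The extension property `hextΔ` at the stage-2 Tate model: GALOIS-TRIVIAL PAIRS `(φ, e)` —
# a two-way CONSTRUCTOR removing `G_{ℚ_p}` from the binder (proof-only; K-L6 row «HEXT-GALOISFREE@modelχq»)

S. Mochizuki, *The étale theta function and its Frobenioid-theoretic manifestations* [EtTh], Publ. RIMS **45** (2009)
(refereed), §2, Prop. 2.4 p. 38 (every automorphism of `Π^tp_{X̲̲}` arises from one of `Π^tp_X`) [cite: MochizukiEtTh2009,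
Prop 2.4 p.38]; §1 p. 12 (`Π^tp_X`, `Δ^tp_X`), p. 13 (the Galois action through `(κ_p, χ)`); Def. 2.5 (i) p. 39 (`X̲̲`).

Cell `abc-iut`, seat abc-iut-w5-d125 (gen 12; K-L6 row «HEXT-GALOISFREE@modelχq», abc-iut-L6-lead §F v1.19eg (C) GO
2026-08-27T05:20:44Z).  PROOF-ONLY companion of abc-iut-w5-d169's reduction `SettingModel.hext_at_iff_exists_gfpAut'`
(p497819 / p498683) and of abc-iut-L6-t13's geometric core `SettingModel.hext_at_iff_exists_gfpAut_extends` (p502505: clause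
(ii) is redundant, `actχq_mem_dUU_of_clauses`), both consumed BY NAME: NO definition, NO instance, NO new named fact.

THE BINDER (K-L6 cell, verdict of record «UNDECIDED-AT-MODEL»):
  `hextΔ : ∀ γ : Π^tp_{X̲̲} ≃ₜ* Π^tp_{X̲̲}, ∃ Γ : Π^tp_X ≃ₜ* Π^tp_X, Γ|_{Π^tp_{X̲̲}} = γ ∧ Γ(Δ^tp_X) = Δ^tp_X`
at an `X̲̲`-choice `C` over `modelχq p i j` with `Π^tp_{X̲̲} = dUU l ⋊ G_{ℚ_p}` (membership clauses `hinl`, `hinr`, `hleft`,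
exactly as in the reduction file), `Π^tp_X = Γ ⋊_{actχq} G_{ℚ_p}` (`Γ = Gfp = F̂₂ ×_Ẑ ℤ`).

WHAT THIS FILE PROVES.  Call `γ` GALOIS-TRIVIAL if `(γ h).right = h.right` for all `h` (it induces the identity on
`Π^tp_{X̲̲}/inl(dUU l) = G_{ℚ_p}`).  A PAIR is `(φ, e)` with `φ : dUU l ≃ₜ* dUU l` bi-continuous, `e : G_{ℚ_p} → dUU l`
continuous, subject to the two ALGEBRAIC LAWS
  (C) `e (σ τ) = e σ · σ·(e τ)`                      (cocycle law),
  (E) `φ (σ·d) = e σ · σ·(φ d) · (e σ)⁻¹` on `dUU l`  (twisted equivariance),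
where `σ·g = actχq p i j σ g`.
§1 `exists_continuousMulEquiv_of_pair` — CONSTRUCTOR: every pair IS a Galois-trivial bi-continuous automorphism
   `γ_{φ,e}` of `Π^tp_{X̲̲}`: `γ (inl d · inr σ) = inl (φ d · e σ) · inr σ` (so `γ(inl d) = inl (φ d)`, `γ(inr σ) = inl (e σ) · inr σ`).
§2 `exists_pair_of_forall_right_eq` — CONVERSELY every Galois-trivial `γ` is `γ_{φ,e}` for a (unique) pair.
§3 `hext_at_iff_of_pair` — over `hext_at_iff_exists_gfpAut_extends` BY NAME: for `γ` with `γ (inl d) = inl (φ d)`,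
   `hextΔ(γ) ⟺ ∃ Φ : Γ ≃ₜ* Γ, Φ|_{dUU l} = φ` (then `Φ (σ·g) = e σ · σ·(Φ g) · (e σ)⁻¹` is automatic, p502505); `not_hextΔ_of_pair`:
   a pair whose `φ` does NOT extend to `Aut_top(Γ)` refutes the binder `hextΔ` at `C`; `hext_at_of_forall_right_eq_of_forall_pair`:
   if the `φ` of EVERY pair extends, every Galois-trivial `γ` satisfies `hextΔ(γ)`.
§4 `e_eq_one_of_actχq_eq_one` / `e_eq_of_tatePairHom_eq` — the laws only SEE `σ` through `actχq σ = affTwist₃Gfp (tatePairHom σ)`: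
   by (E), surjectivity of `φ` and SLIMNESS of `Γ` (abc-iut-w5-d111's `isSlimGroup_gfp`, `dUU l` open), `e` is trivial on
   `Ker(actχq)` and hence FACTORS THROUGH `tatePairHom : G_{ℚ_p} → (Ẑ × Ẑ) ⋊ Ẑ^×` (image `T`, two `Ẑ`-coordinates and a unit):
   hunts for / proofs about Galois-trivial `γ` range over continuous maps on `T`, not on `G_{ℚ_p}`.
CELL USE (honest words): the Galois-trivial refuter/prover target for `hextΔ` (and for its consequence `hΘ`) is EXACT and
GALOIS-FREE — pairs `(φ, e)` over `T`; Galois-NONtrivial `γ` (exotic on `G_{ℚ_p}`) are NOT covered.  Neither direction claimed.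

HONEST LABEL. `modelχq` is a SEMI-SYNTHETIC model of the typed [EtTh] §1 interface (not the tempered `π₁` of a curve): a
statement about OUR model and OUR typed binder only; nothing of [EtTh] / [IUTchII] (claim key `Mochizuki2012`, DISPUTED,
D-0012) is asserted; no side is taken on [IUTchIII] Cor. 3.12; typed ≠ proved; nothing here bears on whether abc is proved
or refuted. bears_on: LADDER-ABC:A2.L-K (K-L6 «HEXT-GALOISFREE@modelχq») → LADDER-FRONTIER F-A2 (M·L6) → rung 0 `Summit.ABC`.
-/

set_option autoImplicit false

noncomputable section

namespace Literature.AnabelianGeometry.EtaleTheta.SettingModel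

open Literature.AnabelianGeometry.SemiGraphs
open Literature.IUT.HodgeArakelov Literature.IUT.HodgeArakelov.EtaleThetaDataOfSetting
open Literature.AlgebraicGeometry.Frobenioids (IsSlimGroup)
open Function
open _root_.Topology

variable {p : ℕ} [Fact p.Prime] {i j : ℤ} {hj : Even j} {E : (ThetaSetting.modelχq p i j hj).EtaleThetaData} {l : ℕ}
  (C : E.DoubleUnderline l) {l' : ℕ+}
  (hinl : ∀ d ∈ dUU l', (SemidirectProduct.inl d : PiTpχq p i j) ∈ C.Huu)
  (hinr : ∀ σ : GQp p, (SemidirectProduct.inr σ : PiTpχq p i j) ∈ C.Huu)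
  (hleft : ∀ h ∈ C.Huu, (h : PiTpχq p i j).left ∈ dUU l')

/-! ## §0. Two algebraic identities in `Π^tp_X = Γ ⋊ G_{ℚ_p}` -/

/-- `(inl u · inr σ) · inl g · (inl u · inr σ)⁻¹ = inl (u · σ·g · u⁻¹)`. [cite: MochizukiEtTh2009, §1 p.12] -/
theorem inl_mul_inr_conj_inl (u g : Gfp) (σ : GQp p) :
    (SemidirectProduct.inl u * SemidirectProduct.inr σ : PiTpχq p i j) * SemidirectProduct.inl g *
        (SemidirectProduct.inl u * SemidirectProduct.inr σ)⁻¹ =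
      SemidirectProduct.inl (u * actχq p i j σ g * u⁻¹) := by
  rw [map_mul, map_mul, map_inv, SemidirectProduct.inl_aut, mul_inv_rev, ← map_inv]
  simp only [mul_assoc]

/-! ## §1. CONSTRUCTOR: a pair `(φ, e)` with the laws (C), (E) is a Galois-trivial automorphism of `Π^tp_{X̲̲}` -/

include hinl hinr hleft in
/-- **CONSTRUCTOR.**  Let `φ` be a bi-continuous automorphism of `dUU l` and `e : G_{ℚ_p} → dUU l` continuous with
(C) `e (σ τ) = e σ · σ·(e τ)` and (E) `φ (σ·d) = e σ · σ·(φ d) · (e σ)⁻¹`.  Then there is a bi-continuous automorphism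
`γ` of `Π^tp_{X̲̲}` with `γ (h) = inl (φ h.left · e h.right) · inr h.right`; in particular `γ (inl d) = inl (φ d)`,
`γ (inr σ) = inl (e σ) · inr σ`, and `γ` is Galois-trivial. [cite: MochizukiEtTh2009, Prop 2.4 p.38] -/
theorem exists_continuousMulEquiv_of_pair (φ : ↥(dUU l') ≃ₜ* ↥(dUU l')) (e : GQp p → Gfp)
    (he : ∀ σ, e σ ∈ dUU l') (hec : Continuous e)
    (hcoc : ∀ σ τ, e (σ * τ) = e σ * actχq p i j σ (e τ))
    (heqv : ∀ (σ : GQp p) (d : ↥(dUU l')) (hσd : actχq p i j σ (d : Gfp) ∈ dUU l'),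
      ((φ ⟨actχq p i j σ d, hσd⟩ : ↥(dUU l')) : Gfp) = e σ * actχq p i j σ (φ d : Gfp) * (e σ)⁻¹) :
    ∃ γ : ↥C.Huu ≃ₜ* ↥C.Huu,
      (∀ h : C.Huu, ((γ h : C.Huu) : PiTpχq p i j) =
          SemidirectProduct.inl ((φ ⟨(h : PiTpχq p i j).left, hleft _ h.2⟩ : Gfp) * e (h : PiTpχq p i j).right) *
            SemidirectProduct.inr (h : PiTpχq p i j).right) ∧
      (∀ (d : Gfp) (hd : d ∈ dUU l'),
          ((γ ⟨SemidirectProduct.inl d, hinl d hd⟩ : C.Huu) : PiTpχq p i j) =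
            SemidirectProduct.inl ((φ ⟨d, hd⟩ : ↥(dUU l')) : Gfp)) ∧
      (∀ σ : GQp p,
          ((γ ⟨SemidirectProduct.inr σ, hinr σ⟩ : C.Huu) : PiTpχq p i j) =
            SemidirectProduct.inl (e σ) * SemidirectProduct.inr σ) ∧
      (∀ h : C.Huu, ((γ h : C.Huu) : PiTpχq p i j).right = (h : PiTpχq p i j).right) := by
  -- `e 1 = 1`
  have he1 : e 1 = 1 := by
    have h := hcoc 1 1
    rw [mul_one, map_one, MulAut.one_apply] at h
    exact (mul_eq_left.mp h.symm)
  -- the geometric coordinate of `h ∈ Π^tp_{X̲̲}` as an element of `dUU l`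
  let lam : C.Huu → ↥(dUU l') := fun h => ⟨(h : PiTpχq p i j).left, hleft _ h.2⟩
  have hlam : Continuous lam :=
    ((Semidirect.continuous_left (isInducing_leftRightχq p i j)).comp continuous_subtype_val).subtype_mk _
  have hcr : Continuous fun h : C.Huu => (h : PiTpχq p i j).right :=
    (Semidirect.continuous_right (isInducing_leftRightχq p i j)).comp continuous_subtype_val
  -- membership of `⟨u, σ⟩` in `Π^tp_{X̲̲}` for `u ∈ dUU l`
  have hmk : ∀ (u : Gfp) (σ : GQp p), u ∈ dUU l' → (⟨u, σ⟩ : PiTpχq p i j) ∈ C.Huu := fun u σ hu => by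
    rw [SemidirectProduct.mk_eq_inl_mul_inr]
    exact C.Huu.mul_mem (hinl u hu) (hinr σ)
  -- the map and its inverse
  let F : C.Huu → C.Huu := fun h =>
    ⟨⟨(φ (lam h) : Gfp) * e (h : PiTpχq p i j).right, (h : PiTpχq p i j).right⟩,
      hmk _ _ ((dUU l').mul_mem (φ (lam h)).2 (he _))⟩
  let psi : C.Huu → ↥(dUU l') := fun h =>
    ⟨(h : PiTpχq p i j).left * (e (h : PiTpχq p i j).right)⁻¹,
      (dUU l').mul_mem (hleft _ h.2) ((dUU l').inv_mem (he _))⟩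
  have hpsi : Continuous psi :=
    (((Semidirect.continuous_left (isInducing_leftRightχq p i j)).comp continuous_subtype_val).mul
      ((hec.comp hcr).inv)).subtype_mk _
  let F' : C.Huu → C.Huu := fun h =>
    ⟨⟨(φ.symm (psi h) : Gfp), (h : PiTpχq p i j).right⟩, hmk _ _ (φ.symm (psi h)).2⟩
  have hF'F : ∀ h, F' (F h) = h := fun h => by
    have h1 : psi (F h) = φ (lam h) := Subtype.ext (mul_inv_cancel_right _ _)
    refine Subtype.ext (SemidirectProduct.ext ?_ rfl)
    change (φ.symm (psi (F h)) : Gfp) = (h : PiTpχq p i j).left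
    rw [h1, φ.symm_apply_apply]
  have hFF' : ∀ h, F (F' h) = h := fun h => by
    have h1 : lam (F' h) = φ.symm (psi h) := Subtype.ext rfl
    refine Subtype.ext (SemidirectProduct.ext ?_ rfl)
    change (φ (lam (F' h)) : Gfp) * e (h : PiTpχq p i j).right = (h : PiTpχq p i j).left
    rw [h1, φ.apply_symm_apply]
    exact inv_mul_cancel_right _ _
  have hFmul : ∀ x y, F (x * y) = F x * F y := fun x y => by
    have hxy : lam (x * y) = lam x * ⟨actχq p i j (x : PiTpχq p i j).right (lam y : Gfp),
        actχq_mem_dUU_of_clauses C hinl hinr hleft _ (lam y).2⟩ := Subtype.ext rfl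
    have hφxy : (φ (lam (x * y)) : Gfp) = (φ (lam x) : Gfp) *
        (e (x : PiTpχq p i j).right * actχq p i j (x : PiTpχq p i j).right (φ (lam y) : Gfp) *
          (e (x : PiTpχq p i j).right)⁻¹) := by
      rw [hxy, map_mul, Subgroup.coe_mul, heqv]
    refine Subtype.ext (SemidirectProduct.ext ?_ rfl)
    change (φ (lam (x * y)) : Gfp) * e ((x : PiTpχq p i j) * (y : PiTpχq p i j)).right =
      (φ (lam x) : Gfp) * e (x : PiTpχq p i j).right *
        actχq p i j (x : PiTpχq p i j).right ((φ (lam y) : Gfp) * e (y : PiTpχq p i j).right)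
    rw [hφxy, SemidirectProduct.mul_right, hcoc, map_mul]
    group
  have hFc : Continuous F := by
    refine Continuous.subtype_mk ?_ _
    exact (Semidirect.continuous_iff_left_right (isInducing_leftRightχq p i j)).2
      ⟨(continuous_subtype_val.comp (φ.continuous.comp hlam)).mul (hec.comp hcr), hcr⟩
  have hF'c : Continuous F' := by
    refine Continuous.subtype_mk ?_ _
    exact (Semidirect.continuous_iff_left_right (isInducing_leftRightχq p i j)).2
      ⟨continuous_subtype_val.comp (φ.symm.continuous.comp hpsi), hcr⟩
  let γ : ↥C.Huu ≃ₜ* ↥C.Huu :=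
    { toFun := F, invFun := F', left_inv := hF'F, right_inv := hFF', map_mul' := hFmul
      continuous_toFun := hFc, continuous_invFun := hF'c }
  refine ⟨γ, fun h => ?_, fun d hd => ?_, fun σ => ?_, fun h => rfl⟩
  · exact SemidirectProduct.mk_eq_inl_mul_inr _ _
  · change ((⟨(φ (lam ⟨SemidirectProduct.inl d, hinl d hd⟩) : Gfp) * e (SemidirectProduct.inl d : PiTpχq p i j).right,
        (SemidirectProduct.inl d : PiTpχq p i j).right⟩ : PiTpχq p i j)) = _
    have h1 : lam ⟨SemidirectProduct.inl d, hinl d hd⟩ = ⟨d, hd⟩ := Subtype.ext rfl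
    rw [h1, SemidirectProduct.right_inl, he1, mul_one]
    rfl
  · change ((⟨(φ (lam ⟨SemidirectProduct.inr σ, hinr σ⟩) : Gfp) * e (SemidirectProduct.inr σ : PiTpχq p i j).right,
        (SemidirectProduct.inr σ : PiTpχq p i j).right⟩ : PiTpχq p i j)) = _
    have h1 : lam ⟨SemidirectProduct.inr σ, hinr σ⟩ = 1 := Subtype.ext rfl
    rw [h1, map_one, Subgroup.coe_one, one_mul, SemidirectProduct.right_inr, SemidirectProduct.mk_eq_inl_mul_inr]

/-! ## §2. CONVERSELY: every Galois-trivial automorphism of `Π^tp_{X̲̲}` is given by a pair -/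

include hinl hinr hleft in
/-- **Every Galois-trivial bi-continuous automorphism `γ` of `Π^tp_{X̲̲}` IS `γ_{φ,e}`** for the pair
`φ d := (γ (inl d)).left`, `e σ := (γ (inr σ)).left`: `φ` is a bi-continuous automorphism of `dUU l`, `e` is continuous
into `dUU l`, the laws (C), (E) hold, and `γ (inl d) = inl (φ d)`, `γ (inr σ) = inl (e σ) · inr σ`.
[cite: MochizukiEtTh2009, Prop 2.4 p.38] -/
theorem exists_pair_of_forall_right_eq (γ : ↥C.Huu ≃ₜ* ↥C.Huu)
    (hγ : ∀ h : C.Huu, ((γ h : C.Huu) : PiTpχq p i j).right = (h : PiTpχq p i j).right) :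
    ∃ (φ : ↥(dUU l') ≃ₜ* ↥(dUU l')) (e : GQp p → Gfp),
      (∀ σ, e σ ∈ dUU l') ∧ Continuous e ∧
      (∀ σ τ, e (σ * τ) = e σ * actχq p i j σ (e τ)) ∧
      (∀ (σ : GQp p) (d : ↥(dUU l')) (hσd : actχq p i j σ (d : Gfp) ∈ dUU l'),
        ((φ ⟨actχq p i j σ d, hσd⟩ : ↥(dUU l')) : Gfp) = e σ * actχq p i j σ (φ d : Gfp) * (e σ)⁻¹) ∧
      (∀ (d : Gfp) (hd : d ∈ dUU l'),
          ((γ ⟨SemidirectProduct.inl d, hinl d hd⟩ : C.Huu) : PiTpχq p i j) =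
            SemidirectProduct.inl ((φ ⟨d, hd⟩ : ↥(dUU l')) : Gfp)) ∧
      (∀ σ : GQp p,
          ((γ ⟨SemidirectProduct.inr σ, hinr σ⟩ : C.Huu) : PiTpχq p i j) =
            SemidirectProduct.inl (e σ) * SemidirectProduct.inr σ) := by
  have hcl : Continuous fun x : PiTpχq p i j => x.left := Semidirect.continuous_left (isInducing_leftRightχq p i j)
  -- `γ`, `γ⁻¹` map `inl d` to `inl (…)`
  have hγ' : ∀ h : C.Huu, ((γ.symm h : C.Huu) : PiTpχq p i j).right = (h : PiTpχq p i j).right := fun h => by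
    conv_rhs => rw [← γ.apply_symm_apply h]
    exact (hγ _).symm
  have hinlγ : ∀ (d : Gfp) (hd : d ∈ dUU l'), ((γ ⟨SemidirectProduct.inl d, hinl d hd⟩ : C.Huu) : PiTpχq p i j) =
      SemidirectProduct.inl ((γ ⟨SemidirectProduct.inl d, hinl d hd⟩ : C.Huu) : PiTpχq p i j).left := fun d hd =>
    eq_inl_of_right_eq_oneq p i j (by rw [hγ, SemidirectProduct.right_inl])
  have hinlγ' : ∀ (d : Gfp) (hd : d ∈ dUU l'), ((γ.symm ⟨SemidirectProduct.inl d, hinl d hd⟩ : C.Huu) : PiTpχq p i j) =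
      SemidirectProduct.inl ((γ.symm ⟨SemidirectProduct.inl d, hinl d hd⟩ : C.Huu) : PiTpχq p i j).left := fun d hd =>
    eq_inl_of_right_eq_oneq p i j (by rw [hγ', SemidirectProduct.right_inl])
  -- the geometric part `φ`
  let f : ↥(dUU l') → ↥(dUU l') := fun d =>
    ⟨((γ ⟨SemidirectProduct.inl (d : Gfp), hinl _ d.2⟩ : C.Huu) : PiTpχq p i j).left, hleft _ (γ _).2⟩
  let f' : ↥(dUU l') → ↥(dUU l') := fun d =>
    ⟨((γ.symm ⟨SemidirectProduct.inl (d : Gfp), hinl _ d.2⟩ : C.Huu) : PiTpχq p i j).left, hleft _ (γ.symm _).2⟩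
  have hf'f : ∀ d, f' (f d) = d := fun d => by
    apply Subtype.ext
    change ((γ.symm ⟨SemidirectProduct.inl (f d : Gfp), hinl _ (f d).2⟩ : C.Huu) : PiTpχq p i j).left = (d : Gfp)
    have h1 : (⟨SemidirectProduct.inl (f d : Gfp), hinl _ (f d).2⟩ : C.Huu) =
        γ ⟨SemidirectProduct.inl (d : Gfp), hinl _ d.2⟩ := Subtype.ext (hinlγ _ d.2).symm
    rw [h1, γ.symm_apply_apply, SemidirectProduct.left_inl]
  have hff' : ∀ d, f (f' d) = d := fun d => by
    apply Subtype.ext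
    change ((γ ⟨SemidirectProduct.inl (f' d : Gfp), hinl _ (f' d).2⟩ : C.Huu) : PiTpχq p i j).left = (d : Gfp)
    have h1 : (⟨SemidirectProduct.inl (f' d : Gfp), hinl _ (f' d).2⟩ : C.Huu) =
        γ.symm ⟨SemidirectProduct.inl (d : Gfp), hinl _ d.2⟩ := Subtype.ext (hinlγ' _ d.2).symm
    rw [h1, γ.apply_symm_apply, SemidirectProduct.left_inl]
  have hfmul : ∀ a b, f (a * b) = f a * f b := fun a b => by
    apply Subtype.ext
    change ((γ ⟨SemidirectProduct.inl ((a * b : ↥(dUU l')) : Gfp), hinl _ (a * b).2⟩ : C.Huu) : PiTpχq p i j).left =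
      ((γ ⟨SemidirectProduct.inl (a : Gfp), hinl _ a.2⟩ : C.Huu) : PiTpχq p i j).left *
        ((γ ⟨SemidirectProduct.inl (b : Gfp), hinl _ b.2⟩ : C.Huu) : PiTpχq p i j).left
    have h1 : (⟨SemidirectProduct.inl ((a * b : ↥(dUU l')) : Gfp), hinl _ (a * b).2⟩ : C.Huu) =
        ⟨SemidirectProduct.inl (a : Gfp), hinl _ a.2⟩ * ⟨SemidirectProduct.inl (b : Gfp), hinl _ b.2⟩ :=
      Subtype.ext (by
        change (SemidirectProduct.inl ((a * b : ↥(dUU l')) : Gfp) : PiTpχq p i j) =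
          SemidirectProduct.inl (a : Gfp) * SemidirectProduct.inl (b : Gfp)
        rw [Subgroup.coe_mul, map_mul])
    rw [h1, map_mul, Subgroup.coe_mul, SemidirectProduct.mul_left, hγ, SemidirectProduct.right_inl, map_one,
      MulAut.one_apply]
  have hfc : Continuous f :=
    ((hcl.comp continuous_subtype_val).comp
      (γ.continuous.comp (((continuous_inlχq p i j).comp continuous_subtype_val).subtype_mk _))).subtype_mk _
  have hf'c : Continuous f' :=
    ((hcl.comp continuous_subtype_val).comp
      (γ.symm.continuous.comp (((continuous_inlχq p i j).comp continuous_subtype_val).subtype_mk _))).subtype_mk _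
  let φ : ↥(dUU l') ≃ₜ* ↥(dUU l') :=
    { toFun := f, invFun := f', left_inv := hf'f, right_inv := hff', map_mul' := hfmul
      continuous_toFun := hfc, continuous_invFun := hf'c }
  -- the Galois part `e`
  let e : GQp p → Gfp := fun σ => ((γ ⟨SemidirectProduct.inr σ, hinr σ⟩ : C.Huu) : PiTpχq p i j).left
  have hinrγ : ∀ σ, ((γ ⟨SemidirectProduct.inr σ, hinr σ⟩ : C.Huu) : PiTpχq p i j) =
      SemidirectProduct.inl (e σ) * SemidirectProduct.inr σ := fun σ => by
    rw [← SemidirectProduct.mk_eq_inl_mul_inr]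
    exact SemidirectProduct.ext rfl (by rw [hγ, SemidirectProduct.right_inr])
  refine ⟨φ, e, fun σ => hleft _ (γ _).2, ?_, fun σ τ => ?_, fun σ d hσd => ?_, fun d hd => hinlγ d hd, hinrγ⟩
  · exact (hcl.comp continuous_subtype_val).comp (γ.continuous.comp ((continuous_inrχq p i j).subtype_mk _))
  · -- (C): the `left` coordinate of `γ(inr σ) · γ(inr τ) = γ(inr (σ τ))`
    have h1 : (⟨SemidirectProduct.inr (σ * τ), hinr (σ * τ)⟩ : C.Huu) =
        ⟨SemidirectProduct.inr σ, hinr σ⟩ * ⟨SemidirectProduct.inr τ, hinr τ⟩ := Subtype.ext (map_mul _ σ τ)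
    have h2 : ((γ ⟨SemidirectProduct.inr (σ * τ), hinr (σ * τ)⟩ : C.Huu) : PiTpχq p i j) =
        (SemidirectProduct.inl (e σ) * SemidirectProduct.inr σ) * (SemidirectProduct.inl (e τ) * SemidirectProduct.inr τ) := by
      rw [h1, map_mul, Subgroup.coe_mul, hinrγ, hinrγ]
    have h3 := congrArg (fun x : PiTpχq p i j => x.left) h2
    simpa only [SemidirectProduct.mul_left, SemidirectProduct.mul_right, SemidirectProduct.left_inl,
      SemidirectProduct.right_inl, SemidirectProduct.left_inr, SemidirectProduct.right_inr, map_one, MulAut.one_apply,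
      mul_one, one_mul] using h3
  · -- (E): the `left` coordinate of `γ(inl (σ·d)) = γ(inr σ) · γ(inl d) · γ(inr σ)⁻¹`
    have h1 : (⟨SemidirectProduct.inl (actχq p i j σ (d : Gfp)), hinl _ hσd⟩ : C.Huu) =
        ⟨SemidirectProduct.inr σ, hinr σ⟩ * ⟨SemidirectProduct.inl (d : Gfp), hinl _ d.2⟩ *
          (⟨SemidirectProduct.inr σ, hinr σ⟩)⁻¹ :=
      Subtype.ext (by
        change (SemidirectProduct.inl (actχq p i j σ (d : Gfp)) : PiTpχq p i j) =
          SemidirectProduct.inr σ * SemidirectProduct.inl (d : Gfp) * (SemidirectProduct.inr σ)⁻¹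
        rw [← map_inv]
        exact SemidirectProduct.inl_aut σ _)
    have h2 : ((γ ⟨SemidirectProduct.inl (actχq p i j σ (d : Gfp)), hinl _ hσd⟩ : C.Huu) : PiTpχq p i j) =
        SemidirectProduct.inl (e σ * actχq p i j σ (φ d : Gfp) * (e σ)⁻¹) := by
      rw [h1, map_mul, map_mul, map_inv, Subgroup.coe_mul, Subgroup.coe_mul, Subgroup.coe_inv, hinrγ, hinlγ _ d.2,
        inl_mul_inr_conj_inl]
      rfl
    have h3 := congrArg (fun x : PiTpχq p i j => x.left) h2
    change ((γ ⟨SemidirectProduct.inl (actχq p i j σ (d : Gfp)), hinl _ hσd⟩ : C.Huu) : PiTpχq p i j).left = _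
    simpa only [SemidirectProduct.left_inl] using h3

/-! ## §3. `hextΔ(γ_{φ,e})` ⟺ `φ` extends to a bi-continuous automorphism of `Γ` -/

include hinl hinr hleft in
/-- **`hextΔ` FOR A GALOIS-TRIVIAL AUTOMORPHISM = AN EXTENSION PROBLEM IN `Aut_top(Γ)` ALONE.**  For `γ` with
`γ (inl d) = inl (φ d)` on `dUU l` (every Galois-trivial `γ`, §2; every pair, §1): `γ` extends to a `Δ^tp_X`-stabilising
bi-continuous automorphism of `Π^tp_X` IFF `φ` is the restriction of a bi-continuous automorphism `Φ` of `Γ` — abc-iut-L6-t13's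
`hext_at_iff_exists_gfpAut_extends` with clause (i) rewritten through the value clause (the twisted equivariance
`Φ (σ·g) = e σ · σ·(Φ g) · (e σ)⁻¹` then holds automatically, p502505 `twisted_equivariance_of_extends`).
[cite: MochizukiEtTh2009, Prop 2.4 p.38] -/
theorem hext_at_iff_of_pair (φ : ↥(dUU l') ≃ₜ* ↥(dUU l')) (γ : ↥C.Huu ≃ₜ* ↥C.Huu)
    (hγl : ∀ (d : Gfp) (hd : d ∈ dUU l'),
      ((γ ⟨SemidirectProduct.inl d, hinl d hd⟩ : C.Huu) : PiTpχq p i j) = SemidirectProduct.inl ((φ ⟨d, hd⟩ : ↥(dUU l')) : Gfp)) :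
    (∃ Γ : PiTpχq p i j ≃ₜ* PiTpχq p i j,
      (∀ h : C.Huu, Γ (h : PiTpχq p i j) = ((γ h : C.Huu) : PiTpχq p i j)) ∧
        (curveχq p i j).DeltaTemp.map Γ.toMulEquiv.toMonoidHom = (curveχq p i j).DeltaTemp) ↔
    ∃ Φ : Gfp ≃ₜ* Gfp, ∀ (d : Gfp) (hd : d ∈ dUU l'), Φ d = (φ ⟨d, hd⟩ : ↥(dUU l')) := by
  rw [hext_at_iff_exists_gfpAut_extends C hinl hinr hleft γ]
  refine exists_congr fun Φ => forall_congr' fun d => forall_congr' fun hd => ?_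
  rw [hγl, SemidirectProduct.inl_inj]

include hinl hinr hleft in
/-- **REFUTER FORM (`not_hextΔ_of_pair`).**  A pair `(φ, e)` with the laws (C), (E) whose `φ` is NOT the restriction of a
bi-continuous automorphism of `Γ` REFUTES the binder `hextΔ` at `C`: the Galois-trivial automorphism `γ_{φ,e}` of §1 does not
extend.  (No such pair is exhibited here.) [cite: MochizukiEtTh2009, Prop 2.4 p.38] -/
theorem not_hextΔ_of_pair (φ : ↥(dUU l') ≃ₜ* ↥(dUU l')) (e : GQp p → Gfp)
    (he : ∀ σ, e σ ∈ dUU l') (hec : Continuous e)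
    (hcoc : ∀ σ τ, e (σ * τ) = e σ * actχq p i j σ (e τ))
    (heqv : ∀ (σ : GQp p) (d : ↥(dUU l')) (hσd : actχq p i j σ (d : Gfp) ∈ dUU l'),
      ((φ ⟨actχq p i j σ d, hσd⟩ : ↥(dUU l')) : Gfp) = e σ * actχq p i j σ (φ d : Gfp) * (e σ)⁻¹)
    (hno : ¬ ∃ Φ : Gfp ≃ₜ* Gfp, ∀ (d : Gfp) (hd : d ∈ dUU l'), Φ d = (φ ⟨d, hd⟩ : ↥(dUU l'))) :
    ¬ ∀ γ : ↥C.Huu ≃ₜ* ↥C.Huu, ∃ Γ : PiTpχq p i j ≃ₜ* PiTpχq p i j,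
        (∀ h : C.Huu, Γ (h : PiTpχq p i j) = ((γ h : C.Huu) : PiTpχq p i j)) ∧
          (curveχq p i j).DeltaTemp.map Γ.toMulEquiv.toMonoidHom = (curveχq p i j).DeltaTemp := by
  intro hext
  obtain ⟨γ, -, hγl, -, -⟩ := exists_continuousMulEquiv_of_pair C hinl hinr hleft φ e he hec hcoc heqv
  exact hno ((hext_at_iff_of_pair C hinl hinr hleft φ γ hγl).1 (hext γ))

include hinl hinr hleft in
/-- **PROVER FORM, Galois-trivial case.**  If the `φ` of EVERY pair `(φ, e)` with the laws (C), (E) is the restriction of a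
bi-continuous automorphism of `Γ`, then every Galois-trivial bi-continuous automorphism of `Π^tp_{X̲̲}` satisfies the clause
`hextΔ(γ)`.  (Galois-NONtrivial `γ` are not covered.) [cite: MochizukiEtTh2009, Prop 2.4 p.38] -/
theorem hext_at_of_forall_right_eq_of_forall_pair
    (hall : ∀ (φ : ↥(dUU l') ≃ₜ* ↥(dUU l')) (e : GQp p → Gfp), (∀ σ, e σ ∈ dUU l') → Continuous e →
      (∀ σ τ, e (σ * τ) = e σ * actχq p i j σ (e τ)) →
      (∀ (σ : GQp p) (d : ↥(dUU l')) (hσd : actχq p i j σ (d : Gfp) ∈ dUU l'),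
        ((φ ⟨actχq p i j σ d, hσd⟩ : ↥(dUU l')) : Gfp) = e σ * actχq p i j σ (φ d : Gfp) * (e σ)⁻¹) →
      ∃ Φ : Gfp ≃ₜ* Gfp, ∀ (d : Gfp) (hd : d ∈ dUU l'), Φ d = (φ ⟨d, hd⟩ : ↥(dUU l')))
    (γ : ↥C.Huu ≃ₜ* ↥C.Huu) (hγ : ∀ h : C.Huu, ((γ h : C.Huu) : PiTpχq p i j).right = (h : PiTpχq p i j).right) :
    ∃ Γ : PiTpχq p i j ≃ₜ* PiTpχq p i j,
      (∀ h : C.Huu, Γ (h : PiTpχq p i j) = ((γ h : C.Huu) : PiTpχq p i j)) ∧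
        (curveχq p i j).DeltaTemp.map Γ.toMulEquiv.toMonoidHom = (curveχq p i j).DeltaTemp := by
  obtain ⟨φ, e, he, hec, hcoc, heqv, hγl, -⟩ := exists_pair_of_forall_right_eq C hinl hinr hleft γ hγ
  exact (hext_at_iff_of_pair C hinl hinr hleft φ γ hγl).2 (hall φ e he hec hcoc heqv)

/-! ## §4. The laws only see `σ` through `tatePairHom σ`: `e` factors through `T = tatePairHom(G_{ℚ_p})` -/

/-- The Galois action on `Γ` FACTORS THROUGH `tatePairHom : G_{ℚ_p} → (Ẑ × Ẑ) ⋊ Ẑ^×` (`actχq = affTwist₃Gfp ∘ tatePairHom`):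
its kernel `I` acts trivially. [cite: MochizukiEtTh2009, §1 p.13] -/
theorem actχq_eq_of_tatePairHom_eq {σ σ' : GQp p} (h : tatePairHom p i j σ = tatePairHom p i j σ') :
    actχq p i j σ = actχq p i j σ' := by
  change affTwist₃Gfp (tatePairHom p i j σ) = affTwist₃Gfp (tatePairHom p i j σ')
  rw [h]

/-- **(E) + slimness ⇒ `e` is trivial on `Ker(actχq)`.**  If `(φ, e)` satisfies the twisted equivariance (E) with `φ`
SURJECTIVE onto `dUU l`, then `e τ = 1` for every `τ` acting trivially on `Γ`: `e τ` centralises the open subgroup `dUU l`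
of the SLIM group `Γ` (abc-iut-w5-d111's `isSlimGroup_gfp`). [cite: MochizukiSemiAnbd2006, Ex 3.10 p.45] -/
theorem e_eq_one_of_actχq_eq_one (φ : ↥(dUU l') ≃ₜ* ↥(dUU l')) (e : GQp p → Gfp)
    (heqv : ∀ (σ : GQp p) (d : ↥(dUU l')) (hσd : actχq p i j σ (d : Gfp) ∈ dUU l'),
      ((φ ⟨actχq p i j σ d, hσd⟩ : ↥(dUU l')) : Gfp) = e σ * actχq p i j σ (φ d : Gfp) * (e σ)⁻¹)
    {τ : GQp p} (hτ : actχq p i j τ = 1) : e τ = 1 := by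
  have hmem : e τ ∈ Subgroup.centralizer (dUU l' : Set Gfp) := by
    rw [Subgroup.mem_centralizer_iff]
    intro d' hd'
    let d : ↥(dUU l') := φ.symm ⟨d', hd'⟩
    have hpf : actχq p i j τ (d : Gfp) ∈ dUU l' := by rw [hτ, MulAut.one_apply]; exact d.2
    have h := heqv τ d hpf
    have hsub : (⟨actχq p i j τ (d : Gfp), hpf⟩ : ↥(dUU l')) = d :=
      Subtype.ext (by change actχq p i j τ (d : Gfp) = d; rw [hτ, MulAut.one_apply])
    rw [hsub, hτ, MulAut.one_apply, φ.apply_symm_apply] at h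
    change d' = e τ * d' * (e τ)⁻¹ at h
    rw [eq_mul_inv_iff_mul_eq] at h
    exact h
  rw [isSlimGroup_gfp.centralizer_eq_bot (dUU l') (isOpen_dUU l')] at hmem
  exact Subgroup.mem_bot.mp hmem

/-- **`e` FACTORS THROUGH `tatePairHom`.**  Under (C) and (E) (with `φ` surjective), `e σ = e σ'` whenever
`tatePairHom σ = tatePairHom σ'`: the cocycle `e` of a pair is a function on the image `T = tatePairHom(G_{ℚ_p}) ≤ (Ẑ × Ẑ) ⋊ Ẑ^×`
(two `Ẑ`-coordinates `κ_p^i, κ_p^j` and the unit `χ`), not on `G_{ℚ_p}`. [cite: MochizukiEtTh2009, §1 p.13] -/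
theorem e_eq_of_tatePairHom_eq (φ : ↥(dUU l') ≃ₜ* ↥(dUU l')) (e : GQp p → Gfp)
    (hcoc : ∀ σ τ, e (σ * τ) = e σ * actχq p i j σ (e τ))
    (heqv : ∀ (σ : GQp p) (d : ↥(dUU l')) (hσd : actχq p i j σ (d : Gfp) ∈ dUU l'),
      ((φ ⟨actχq p i j σ d, hσd⟩ : ↥(dUU l')) : Gfp) = e σ * actχq p i j σ (φ d : Gfp) * (e σ)⁻¹)
    {σ σ' : GQp p} (h : tatePairHom p i j σ = tatePairHom p i j σ') : e σ = e σ' := by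
  have hτ : actχq p i j (σ⁻¹ * σ') = 1 := by
    rw [map_mul, map_inv, actχq_eq_of_tatePairHom_eq h, inv_mul_cancel]
  calc e σ = e σ * actχq p i j σ (e (σ⁻¹ * σ')) := by
        rw [e_eq_one_of_actχq_eq_one φ e heqv hτ, map_one, mul_one]
    _ = e (σ * (σ⁻¹ * σ')) := (hcoc σ (σ⁻¹ * σ')).symm
    _ = e σ' := by rw [mul_inv_cancel_left]

end Literature.AnabelianGeometry.EtaleTheta.SettingModel

end
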